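import Mathlib
import Summits.CriticalPhenomena.Ising3DConformalLimit.Theorems.PrecisionLaplacianInverseMFerromagnetSpBase
import Summits.CriticalPhenomena.Ising3DConformalLimit.Theorems.PrecisionLaplacianInverseMFerromagnetSpPendant
import Summits.CriticalPhenomena.Ising3DConformalLimit.Theorems.PrecisionLaplacianInverseMFerromagnetSpParallel
import Summits.CriticalPhenomena.Ising3DConformalLimit.Theorems.PrecisionLaplacianInverseMFerromagnetSpSubdivide
import Summits.CriticalPhenomena.Ising3DConformalLimit.Theorems.PrecisionLaplacianInverseMFerromagnetSpRelabel
import Summits.CriticalPhenomena.Ising3DConformalLimit.Theorems.PrecisionLaplacianInverseMFerromagnetSeriesParallelDefs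
import HarnessLib

/-!
# T-SP: the inverse-M property for every series–parallel ferromagnet
# (crux `PrecisionLaplacian.InverseMFerromagnet`, stmt-CriticalPhenomena-4798, line `Sketch`, lead c3)

THEOREM (`helper_im_seriesParallel`).  For every zero-field pair ferromagnet whose bond structure
`(n, m, C)` is SERIES–PARALLEL (`IsSeriesParallel`, i.e. K₄-minor-free / treewidth ≤ 2, any number of
isolated sites, parallel bonds allowed) and all couplings `K ≥ 0`, the spin second-moment matrix
`Σ_pq = ⟨σ_pσ_q⟩` has `(Σ⁻¹)_xy ≤ 0` for `x ≠ y` — indeed the dressed edge bound DB♯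
`(Σ⁻¹)_xy ≤ −t/(1 + t² − 2tG_xy)` (`helper_db_seriesParallel`; `t = tanh` of the total coupling on
`{x,y}`, `G_xy = ⟨σ_xσ_y⟩`), which is an equality on cycles and at every site of degree ≤ 2.

This is the inverse-M conjecture IM (= the crux, Lauritzen–Uhler–Zwiernik 2021 §5's question, proved
there for CYCLES only, Prop. 5.3) on the first infinite minor-closed class; `K₄` is the first graph
outside it (covered separately by `helper_im_le_five`, IM on ≤ 5 sites).

PROOF = structural induction over `IsSeriesParallel` with the five landed constructor steps (lead c2's
series–parallel programme D6–D8, formalised by the c3 wave): `helper_sp_base` (bondless: Σ = 1),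
`helper_sp_pendant` (1-sum / bordered inverse), `helper_sp_parallel` (Hamiltonian merge),
`helper_sp_subdivide` (2-sum precision formula + Gaussian–Markov factorisation across the 2-separator +
degree-2 equality + the glue inequality = the three-spin sign lemma `κ ≤ 0`), `helper_sp_relabel`.
The whole series–parallel theory of IM is thus "odd functions of two ±1 spins are linear" + "the cubic
Walsh coefficient of `tanh` over three spins is ≤ 0"; beyond the class the reduction lands on 3-connected
graphs, where the open core `stub_law2` (≡ IM) lives.
-/

namespace Summit.CriticalPhenomena.Ising3DConformalLimit.Cruxes.InverseMFerromagnet.PartialCovarianceLadder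

open Literature.Probability.LatticeModels Finset Matrix

noncomputable section

/-- **T-SP (DB♯ form).**  Every series–parallel zero-field pair ferromagnet satisfies the dressed edge
bound `(Σ⁻¹)_xy ≤ −t/(1 + t² − 2tG_xy)`, `t = tanh(total coupling on {x,y})`, `G_xy = ⟨σ_xσ_y⟩`, for all
nonnegative couplings: structural induction over `IsSeriesParallel` with the landed steps
`helper_sp_base/pendant/parallel/subdivide/relabel`. [folklore] -/
theorem helper_db_seriesParallel :
    ∀ (n m : ℕ) (C : Fin m → Finset (Fin n)), IsSeriesParallel n m C →
      ∀ (K : Fin m → ℝ), (∀ i, 0 ≤ K i) → ∀ x y : Fin n, x ≠ y →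
        (Matrix.of fun p q : Fin n => gksExpect Finset.univ K C (fun ω => spinAt p ω * spinAt q ω))⁻¹ x y ≤
          -(Real.tanh (∑ i ∈ Finset.univ.filter (fun i => C i = {x, y}), K i)) /
            (1 + Real.tanh (∑ i ∈ Finset.univ.filter (fun i => C i = {x, y}), K i) ^ 2
              - 2 * Real.tanh (∑ i ∈ Finset.univ.filter (fun i => C i = {x, y}), K i)
                * gksExpect Finset.univ K C (fun ω => spinAt x ω * spinAt y ω)) := by
  intro n m C h
  induction h with
  | base n C =>
      intro K _hK x y hxy
      exact helper_sp_base n 0 K C rfl x y hxy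
  | pendant h v C' hold hnew ih =>
      exact helper_sp_pendant _ _ _ (isSeriesParallel_card_eq_two _ _ _ h) ih v C' hold hnew
  | parallel h i₀ C' hold hnew ih =>
      exact helper_sp_parallel _ _ _ (isSeriesParallel_card_eq_two _ _ _ h) ih i₀ C' hold hnew
  | subdivide h i₀ a b hab hi₀ C' hold hi₀' hnew ih =>
      exact helper_sp_subdivide _ _ _ (isSeriesParallel_card_eq_two _ _ _ h) ih i₀ a b hab hi₀ C' hold hi₀' hnew
  | relabel h eV eι C' hC' ih =>
      exact helper_sp_relabel _ _ _ (isSeriesParallel_card_eq_two _ _ _ h) ih eV eι C' hC'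

/-- `⟨σ_xσ_y⟩ ≤ 1` (`|σ_xσ_y| = 1` pointwise). [folklore] -/
theorem tsp_gksExpect_pair_le_one {n m : ℕ} (K : Fin m → ℝ) (C : Fin m → Finset (Fin n)) (x y : Fin n) :
    gksExpect Finset.univ K C (fun ω => spinAt x ω * spinAt y ω) ≤ 1 := by
  -- adapted from `Literature.Probability.LatticeModels.TwoPointPlusDecay.gksExpect_pair_le_one`
  rw [gksExpect, div_le_one (gksSum_one_pos _ _ _)]
  simp only [gksSum]
  refine Finset.sum_le_sum fun ω _ => mul_le_mul_of_nonneg_right ?_ (gksWeight_pos _ _ _ ω).le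
  have h : |spinAt x ω * spinAt y ω| ≤ 1 :=
    le_of_eq (by rw [abs_mul, abs_spinAt, abs_spinAt, mul_one])
  exact (abs_le.1 h).2

/-- **T-SP (IM form): the inverse-M property holds for every SERIES–PARALLEL zero-field pair
ferromagnet** (K₄-minor-free interaction multigraph, arbitrary nonnegative couplings): off-diagonal
entries of `Σ⁻¹` are `≤ 0` — indeed `≤ −t/(1+t²−2tG) ≤ 0`.  First extension of Lauritzen–Uhler–Zwiernik
2021, Prop. 5.3 (cycles) to an infinite minor-closed class; `K₄` is the first graph outside it (covered by
`helper_im_le_five`). [folklore] -/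
theorem helper_im_seriesParallel :
    ∀ (n m : ℕ) (K : Fin m → ℝ) (C : Fin m → Finset (Fin n)), IsSeriesParallel n m C → (∀ i, 0 ≤ K i) →
      ∀ x y : Fin n, x ≠ y →
        (Matrix.of fun p q : Fin n => gksExpect Finset.univ K C (fun ω => spinAt p ω * spinAt q ω))⁻¹ x y ≤ 0 := by
  intro n m K C hSP hK x y hxy
  refine (helper_db_seriesParallel n m C hSP K hK x y hxy).trans ?_
  set t := Real.tanh (∑ i ∈ Finset.univ.filter (fun i => C i = {x, y}), K i) with ht
  set G := gksExpect Finset.univ K C (fun ω => spinAt x ω * spinAt y ω) with hGdef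
  have ht0 : 0 ≤ t := by
    rw [ht, Real.tanh_eq_sinh_div_cosh]
    exact div_nonneg (Real.sinh_nonneg_iff.2 (Finset.sum_nonneg fun i _ => hK i))
      (Real.cosh_pos _).le
  have ht1 : t < 1 := by rw [ht]; exact Real.tanh_lt_one _
  have hG : G ≤ 1 := by rw [hGdef]; exact tsp_gksExpect_pair_le_one K C x y
  -- `1 + t² − 2tG ≥ 1 + t² − 2t = (1 − t)² > 0`
  have hden : 0 < 1 + t ^ 2 - 2 * t * G := by
    nlinarith [mul_le_mul_of_nonneg_left hG ht0, pow_pos (sub_pos.2 ht1) 2]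
  rw [neg_div]
  exact neg_nonpos.mpr (div_nonneg ht0 hden.le)

end

end Summit.CriticalPhenomena.Ising3DConformalLimit.Cruxes.InverseMFerromagnet.PartialCovarianceLadder
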